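import Literature.Geometry.Lorentzian.IPlusRegular
import Literature.Geometry.Lorentzian.KillingOnIntegralCurveUnique
import Literature.Geometry.Lorentzian.GeodesicProofs
import Literature.Geometry.Manifold.MaximalIntegralCurve
import HarnessLib

/-!
# Crux `HawkingExtensionIsKerr` (stmt-FinalStateConjecture-17840), line `SketchIdeator2` —
# programme SEC, brick SEC-3b: `K`-lines extend to generators; cross-sections meet chart lines once

Helper file of the line lead (c7), registered sub-goal `stub_sec_generator` (the global half of
SEC-3).  Setting: a stationary asymptotically flat black hole `𝓑` (`StationaryAFBlackHole`), an open
`U ⊇ 𝓔⁺ = 𝓑.horizon` and a Killing field `K` of `𝓑.metric` on `U` (`IsKillingFieldOn`); `hnull`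
(the statement of brick SEC-3a, `stub_sec_nullLine`) gives a sign `ε = ±1` for which every integral
curve of `K` on `(a, b)` inside `𝓔⁺` reparametrises to a future-directed null geodesic segment
`t ↦ γ₀ (ε t)` in `𝓔⁺` (`LorentzianMetric.IsNullGeodesicIn`); `hcharts` (bricks SEC-1/2) gives
`K`-charts `(W, O, χ, χi)` at the points of `𝓔⁺` (`χ : W → O ⊆ ℝ⁴` with inverse `χi`,
`𝓔⁺ ∩ W = {χ · 1 = 0}`, (a) the chart lines `σ ↦ χi (y + σ e₀)` are integral curves of `K`,
(b) integral curves of `K` inside `W` read `χ (γ t) = χ (γ t₀) + (t - t₀) e₀`).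

Proof: a `K`-line `γ₀` in `𝓔⁺` extends to a MAXIMAL `K`-line `θ` in `𝓔⁺` on an open interval `D`
(`exists_maximal_line`: union of all extensions, consistent by uniqueness of integral curves of the
local Killing field, Lee 2013, Thm. 9.12 (a)); such a `θ` is not prolonged inside `𝓔⁺` even by a
continuous curve (`extend_past_limitPoint`, `subset_of_forall_extension_subset`: at an endpoint `β`
of `D` with limit point `q ∈ 𝓔⁺`, (b) and continuity give `χ q = χ (θ u₂) + (β - u₂) e₀`, so near
`β` the curve `θ` is the chart line through `q`, an integral curve of `K` in `𝓔⁺` by (a) defined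
past `β`).  Hence (GEN) `t ↦ θ (ε t)` is a generator of `𝓔⁺` (`IsNullGeneratorOf`) through `γ₀`,
and (INJ) two points of a cross-section `C` of `𝓔⁺` (`IsCrossSectionOf`) on one chart line (convex
`O`) are joined by a `K`-line in `𝓔⁺`, which lies on a generator meeting `C` once, so coincide.
Chruściel–Costa 2008, §4.1 (generators and cross-sections of `𝓔⁺`); the argument is elementary.
-/

noncomputable section

set_option linter.dupNamespace false

namespace Summit.FinalStateConjecture.FinalStateConjecture.Theorems.HawkingExtensionIsKerr.SketchIdeator2

open Set Filter Bundle Function Literature.Geometry.Lorentzian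
open scoped Manifold ContDiff Topology

/-! ### Maximal `K`-lines inside the horizon -/

/-- **Maximal extension of a `K`-line inside `𝓔⁺`.** An integral curve `γ₀` of the local Killing
field `K` (Killing on the open `U ⊇ 𝓔⁺`) on `(a, b)`, `a < b`, lying in `𝓔⁺`, extends to an
integral curve `θ` of `K` in `𝓔⁺` on an open interval `D ⊇ (a, b)` containing every other such
extension: the union of all extensions, any two of which agree on the intersection of their domains
by uniqueness of integral curves inside `U` (`IsKillingFieldOn.eqOn_of_isMIntegralCurveOn`).
Lee 2013, Thm. 9.12 (a). [cite: LeeSmoothManifolds2013, Thm. 9.12 (a)] -/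
private theorem exists_maximal_line {𝓑 : StationaryAFBlackHole.{0}} [𝓑.metric.HasLeviCivita]
    {U : Set 𝓑.carrier} {K : Π x : 𝓑.carrier, TangentSpace (𝓡 4) x} (hU : IsOpen U)
    (hEU : 𝓑.horizon ⊆ U) (hK : 𝓑.metric.toPseudoRiemannianMetric.IsKillingFieldOn K U)
    {γ₀ : ℝ → 𝓑.carrier} {a b : ℝ} (hab : a < b) (hγ₀ : IsMIntegralCurveOn γ₀ K (Ioo a b))
    (hγ₀E : ∀ t ∈ Ioo a b, γ₀ t ∈ 𝓑.horizon) :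
    ∃ (θ : ℝ → 𝓑.carrier) (D : Set ℝ), IsOpen D ∧ D.OrdConnected ∧ Ioo a b ⊆ D ∧
      EqOn θ γ₀ (Ioo a b) ∧ IsMIntegralCurveOn θ K D ∧ (∀ t ∈ D, θ t ∈ 𝓑.horizon) ∧
      ∀ (γ₂ : ℝ → 𝓑.carrier) (J₂ : Set ℝ), IsOpen J₂ → J₂.OrdConnected → Ioo a b ⊆ J₂ →
        EqOn γ₂ γ₀ (Ioo a b) → IsMIntegralCurveOn γ₂ K J₂ → (∀ t ∈ J₂, γ₂ t ∈ 𝓑.horizon) →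
        J₂ ⊆ D ∧ EqOn γ₂ θ J₂ := by
  classical
  -- the admissible extensions of `γ₀`
  set S : Set ((ℝ → 𝓑.carrier) × Set ℝ) := {p | IsOpen p.2 ∧ p.2.OrdConnected ∧ Ioo a b ⊆ p.2 ∧
    EqOn p.1 γ₀ (Ioo a b) ∧ IsMIntegralCurveOn p.1 K p.2 ∧ ∀ t ∈ p.2, p.1 t ∈ 𝓑.horizon} with hS
  have hm : (a + b) / 2 ∈ Ioo a b := ⟨by linarith, by linarith⟩
  -- consistency: two extensions agree on the intersection of their domains
  have hcons : ∀ p ∈ S, ∀ q ∈ S, ∀ t ∈ p.2 ∩ q.2, p.1 t = q.1 t := fun p hp q hq t ht ↦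
    hK.eqOn_of_isMIntegralCurveOn hU (hp.1.inter hq.1) (hp.2.1.inter hq.2.1)
      ⟨hp.2.2.1 hm, hq.2.2.1 hm⟩ (hp.2.2.2.2.1.mono inter_subset_left)
      (hq.2.2.2.2.1.mono inter_subset_right) (fun t ht ↦ hEU (hp.2.2.2.2.2 t ht.1))
      (fun t ht ↦ hEU (hq.2.2.2.2.2 t ht.2)) ((hp.2.2.2.1 hm).trans (hq.2.2.2.1 hm).symm) ht
  have hp₀ : (γ₀, Ioo a b) ∈ S :=
    ⟨isOpen_Ioo, ordConnected_Ioo, Subset.rfl, fun _ _ ↦ rfl, hγ₀, hγ₀E⟩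
  set D : Set ℝ := ⋃ p ∈ S, p.2 with hD
  have hmemD : ∀ {t}, t ∈ D ↔ ∃ p ∈ S, t ∈ p.2 := by
    intro t; simp only [hD, mem_iUnion, exists_prop]
  set θ : ℝ → 𝓑.carrier := fun t ↦ if h : ∃ p ∈ S, t ∈ p.2 then h.choose.1 t else γ₀ t with hθ
  -- `θ` agrees with every extension on its domain
  have hθeq : ∀ p ∈ S, EqOn θ p.1 p.2 := by
    intro p hp t ht
    have h : ∃ p ∈ S, t ∈ p.2 := ⟨p, hp, ht⟩
    simp only [hθ, dif_pos h]
    exact hcons _ h.choose_spec.1 p hp t ⟨h.choose_spec.2, ht⟩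
  have habD : Ioo a b ⊆ D := fun t ht ↦ hmemD.2 ⟨_, hp₀, ht⟩
  refine ⟨θ, D, isOpen_biUnion fun p hp ↦ hp.1, ?_, habD, hθeq _ hp₀, ?_, ?_,
    fun γ₂ J₂ hJo hJc hJab hJeq hJint hJE ↦ ?_⟩
  · refine ⟨fun a₁ ha₁ b₁ hb₁ u hu ↦ ?_⟩
    rcases le_total ((a + b) / 2) u with hu0 | hu0
    · obtain ⟨p, hp, hbp⟩ := hmemD.1 hb₁
      exact hmemD.2 ⟨p, hp, hp.2.1.out (hp.2.2.1 hm) hbp ⟨hu0, hu.2⟩⟩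
    · obtain ⟨p, hp, hap⟩ := hmemD.1 ha₁
      exact hmemD.2 ⟨p, hp, hp.2.1.out hap (hp.2.2.1 hm) ⟨hu.1, hu0⟩⟩
  · intro t ht
    obtain ⟨p, hp, htp⟩ := hmemD.1 ht
    exact (((hp.2.2.2.2.1.congr_of_eqOn_isOpen hp.1 (hθeq p hp)).hasMFDerivAt_of_isOpen hp.1
      htp).hasMFDerivWithinAt)
  · intro t ht
    obtain ⟨p, hp, htp⟩ := hmemD.1 ht
    rw [hθeq p hp htp]
    exact hp.2.2.2.2.2 t htp
  · have hp₂ : (γ₂, J₂) ∈ S := ⟨hJo, hJc, hJab, hJeq, hJint, hJE⟩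
    exact ⟨fun t ht ↦ hmemD.2 ⟨_, hp₂, ht⟩, fun t ht ↦ (hθeq _ hp₂ ht).symm⟩

/-- **Extension past a limit endpoint.** Let `θ` be an integral curve of `K` in `𝓔⁺` on the open
interval `D`, `β ∈ closure D`, and `θ u → q ∈ 𝓔⁺` as `u → β` inside `D`, where `q` has a `K`-chart
`(W, O, χ, χi)` (`χ` continuous, inverse relations, `𝓔⁺ ∩ W = {χ · 1 = 0}`, (a) chart lines are
integral curves of `K`, (b) integral curves of `K` in `W` read `χ (γ t) = χ (γ t₀) + (t - t₀) e₀`).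
Then `θ` extends to an integral curve of `K` in `𝓔⁺` on an open interval containing `D` and `β`:
by (b) and continuity `χ q = χ (θ u₂) + (β - u₂) e₀`, so near `β` the curve `θ` IS the chart line
`u ↦ χi (χ q + (u - β) e₀)` (chart injectivity), an integral curve of `K` in `𝓔⁺` by (a) (its
coordinate `1` is `χ q 1 = 0`) defined around `β`; glue. [cite: LeeSmoothManifolds2013, Thm. 9.12 (a)] -/
private theorem extend_past_limitPoint {𝓑 : StationaryAFBlackHole.{0}}
    {K : Π x : 𝓑.carrier, TangentSpace (𝓡 4) x} {θ : ℝ → 𝓑.carrier} {D : Set ℝ} {β : ℝ}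
    {q : 𝓑.carrier} {W : Set 𝓑.carrier} {O : Set E4} {χ : 𝓑.carrier → E4} {χi : E4 → 𝓑.carrier}
    (hD : IsOpen D) (hDc : D.OrdConnected) (hθ : IsMIntegralCurveOn θ K D)
    (hθE : ∀ t ∈ D, θ t ∈ 𝓑.horizon) (hβ : β ∈ closure D) (hlim : Tendsto θ (𝓝[D] β) (𝓝 q))
    (hq : q ∈ 𝓑.horizon) (hWo : IsOpen W) (hOo : IsOpen O) (hqW : q ∈ W)
    (hWinv : ∀ x ∈ W, χ x ∈ O ∧ χi (χ x) = x) (hOinv : ∀ y ∈ O, χi y ∈ W ∧ χ (χi y) = y)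
    (hχc : ContinuousOn χ W) (hhor : ∀ x ∈ W, x ∈ 𝓑.horizon ↔ χ x 1 = 0)
    (hlines : ∀ x ∈ W, ∀ a b : ℝ, (∀ σ ∈ Ioo a b, χ x + σ • EuclideanSpace.single 0 1 ∈ O) →
      IsMIntegralCurveOn (fun σ : ℝ ↦ χi (χ x + σ • EuclideanSpace.single 0 1)) K (Ioo a b))
    (hread : ∀ (γ : ℝ → 𝓑.carrier) (a b t₀ : ℝ), t₀ ∈ Ioo a b → IsMIntegralCurveOn γ K (Ioo a b) →
      (∀ t ∈ Ioo a b, γ t ∈ W) →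
      ∀ t ∈ Ioo a b, χ (γ t) = χ (γ t₀) + (t - t₀) • EuclideanSpace.single 0 1) :
    ∃ (γ₂ : ℝ → 𝓑.carrier) (J₂ : Set ℝ), IsOpen J₂ ∧ J₂.OrdConnected ∧ D ⊆ J₂ ∧ β ∈ J₂ ∧
      EqOn γ₂ θ D ∧ IsMIntegralCurveOn γ₂ K J₂ ∧ ∀ t ∈ J₂, γ₂ t ∈ 𝓑.horizon := by
  classical
  set e₀ : E4 := EuclideanSpace.single 0 1 with he₀
  haveI hne : (𝓝[D] β).NeBot := mem_closure_iff_nhdsWithin_neBot.1 hβ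
  -- room in `O` around `χ q` in the direction `e₀`
  obtain ⟨δ, hδ, hδO⟩ : ∃ δ > (0 : ℝ), ∀ σ ∈ Ioo (-δ) δ, χ q + σ • e₀ ∈ O := by
    have hc : Continuous fun σ : ℝ ↦ χ q + σ • e₀ := by fun_prop
    obtain ⟨δ, hδ, hball⟩ := Metric.isOpen_iff.1 (hOo.preimage hc) 0
      (by simpa only [mem_preimage, zero_smul, add_zero] using (hWinv q hqW).1)
    exact ⟨δ, hδ, fun σ hσ ↦ hball (by rw [Real.ball_eq_Ioo, zero_sub, zero_add]; exact hσ)⟩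
  -- near `β` and inside `D` the curve `θ` stays in `W`
  obtain ⟨r, hr, hrδ, hrW⟩ :
      ∃ r > (0 : ℝ), r ≤ δ ∧ ∀ u ∈ Ioo (β - r) (β + r), u ∈ D → θ u ∈ W := by
    obtain ⟨r', hr', hsub⟩ := Metric.mem_nhdsWithin_iff.1 (hlim (hWo.mem_nhds hqW))
    refine ⟨min r' δ, lt_min hr' hδ, min_le_right _ _, fun u hu huD ↦ hsub ⟨?_, huD⟩⟩
    rw [Real.ball_eq_Ioo]
    exact ⟨by linarith [hu.1, min_le_left r' δ], by linarith [hu.2, min_le_left r' δ]⟩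
  have hImem : Ioo (β - r) (β + r) ∩ D ∈ 𝓝[D] β :=
    inter_mem (mem_nhdsWithin_of_mem_nhds (Ioo_mem_nhds (by linarith) (by linarith)))
      self_mem_nhdsWithin
  obtain ⟨u₂, hu₂I, hu₂D⟩ := hne.nonempty_of_mem hImem
  -- (b): chart reading of `θ` near `β`
  have hreadθ : ∀ u ∈ Ioo (β - r) (β + r), u ∈ D → χ (θ u) = χ (θ u₂) + (u - u₂) • e₀ := by
    intro u huI huD
    obtain ⟨a', b', ha', hb', hsub⟩ :=
      Literature.Geometry.Manifold.exists_Ioo_subset_of_isOpen_ordConnected (isOpen_Ioo.inter hD)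
        (ordConnected_Ioo.inter hDc) ⟨hu₂I, hu₂D⟩ ⟨huI, huD⟩
    exact hread θ a' b' u₂ ⟨lt_of_lt_of_le ha' (min_le_left _ _),
      lt_of_le_of_lt (le_max_left _ _) hb'⟩ (hθ.mono (hsub.trans inter_subset_right))
      (fun t ht ↦ hrW t (hsub ht).1 (hsub ht).2) u
      ⟨lt_of_lt_of_le ha' (min_le_right _ _), lt_of_le_of_lt (le_max_right _ _) hb'⟩
  -- the limit `u → β` inside `D`
  have hkey : χ q = χ (θ u₂) + (β - u₂) • e₀ := by
    refine tendsto_nhds_unique_of_eventuallyEq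
      (((hχc q hqW).continuousAt (hWo.mem_nhds hqW)).tendsto.comp hlim)
      (((by fun_prop : Continuous fun u : ℝ ↦ χ (θ u₂) + (u - u₂) • e₀).tendsto β).mono_left
        nhdsWithin_le_nhds) ?_
    filter_upwards [hImem] with u hu using hreadθ u hu.1 hu.2
  -- (a): the chart line through `q`, an integral curve of `K` in `𝓔⁺`
  set L : ℝ → 𝓑.carrier := fun σ ↦ χi (χ q + σ • e₀) with hL
  have hLint : IsMIntegralCurveOn L K (Ioo (-δ) δ) := hlines q hqW (-δ) δ hδO
  have hq1 : χ q 1 = 0 := (hhor q hqW).1 hq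
  have hLE : ∀ σ ∈ Ioo (-δ) δ, L σ ∈ 𝓑.horizon := fun σ hσ ↦
    (hhor _ (hOinv _ (hδO σ hσ)).1).2 (by rw [(hOinv _ (hδO σ hσ)).2]; simp [he₀, hq1])
  -- near `β`, `θ` is this chart line
  have hθL : ∀ u ∈ Ioo (β - r) (β + r), u ∈ D → θ u = L (u - β) := by
    intro u huI huD
    have h1 : χ (θ u) = χ q + (u - β) • e₀ := by
      rw [hreadθ u huI huD, hkey, add_assoc, ← add_smul]; congr 2; ring
    calc θ u = χi (χ (θ u)) := ((hWinv _ (hrW u huI huD)).2).symm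
      _ = L (u - β) := by rw [h1]
  have hLI : IsMIntegralCurveOn (fun u ↦ L (u - β)) K (Ioo (β - r) (β + r)) :=
    (isMIntegralCurveOn_comp_sub.2 hLint).mono fun u hu ↦
      show -δ < u - β ∧ u - β < δ from ⟨by linarith [hu.1], by linarith [hu.2]⟩
  -- glue
  set γ₂ : ℝ → 𝓑.carrier := fun u ↦ if u ∈ D then θ u else L (u - β) with hγ₂
  have hγ₂D : EqOn γ₂ θ D := fun u hu ↦ by simp only [hγ₂, if_pos hu]
  have hγ₂I : EqOn γ₂ (fun u ↦ L (u - β)) (Ioo (β - r) (β + r)) := fun u hu ↦ by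
    by_cases huD : u ∈ D
    · simp only [hγ₂, if_pos huD]
      exact hθL u hu huD
    · simp only [hγ₂, if_neg huD]
  refine ⟨γ₂, D ∪ Ioo (β - r) (β + r), hD.union isOpen_Ioo, ?_, subset_union_left,
    Or.inr ⟨by linarith, by linarith⟩, hγ₂D, ?_, ?_⟩
  · rw [← isPreconnected_iff_ordConnected]
    exact (isPreconnected_iff_ordConnected.2 hDc).union' ⟨u₂, hu₂D, hu₂I⟩ isPreconnected_Ioo
  · intro t ht
    rcases ht with ht | ht
    · exact ((hθ.congr_of_eqOn_isOpen hD hγ₂D).hasMFDerivAt_of_isOpen hD ht).hasMFDerivWithinAt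
    · exact ((hLI.congr_of_eqOn_isOpen isOpen_Ioo hγ₂I).hasMFDerivAt_of_isOpen isOpen_Ioo
        ht).hasMFDerivWithinAt
  · intro t ht
    by_cases htD : t ∈ D
    · rw [hγ₂D htD]; exact hθE t htD
    · simp only [hγ₂, if_neg htD]
      have ht := ht.resolve_left htD
      exact hLE _ ⟨by linarith [ht.1], by linarith [ht.2]⟩

/-- Preimages of intervals under `t ↦ ε t`, `ε = ±1`, are intervals. [folklore] -/
private theorem ordConnected_preimage_sign {ε : ℝ} (hε : ε = 1 ∨ ε = -1) {s : Set ℝ}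
    (hs : s.OrdConnected) : ({t : ℝ | ε * t ∈ s}).OrdConnected := by
  rcases hε with rfl | rfl
  · simpa only [one_mul, setOf_mem_eq] using hs
  · refine ⟨fun x hx y hy z hz ↦ ?_⟩
    simp only [mem_setOf_eq, neg_mul, one_mul] at hx hy ⊢
    exact hs.out hy hx ⟨by linarith [hz.2], by linarith [hz.1]⟩

section Charts

variable {𝓑 : StationaryAFBlackHole.{0}} {U : Set 𝓑.carrier}
  {K : Π x : 𝓑.carrier, TangentSpace (𝓡 4) x}
  (hcharts : ∀ p ∈ 𝓑.horizon, ∃ (W : Set 𝓑.carrier) (O : Set E4) (χ : 𝓑.carrier → E4)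
    (χi : E4 → 𝓑.carrier), IsOpen W ∧ IsOpen O ∧ W ⊆ U ∧ p ∈ W ∧ χ p = 0 ∧
    (∀ x ∈ W, χ x ∈ O ∧ χi (χ x) = x) ∧ (∀ y ∈ O, χi y ∈ W ∧ χ (χi y) = y) ∧
    ContMDiffOn (𝓡 4) 𝓘(ℝ, E4) ∞ χ W ∧ ContMDiffOn 𝓘(ℝ, E4) (𝓡 4) ∞ χi O ∧
    (∀ x ∈ W, mfderiv (𝓡 4) 𝓘(ℝ, E4) χ x (K x) = EuclideanSpace.single 0 1) ∧
    (∀ x ∈ W, x ∈ 𝓑.horizon ↔ χ x 1 = 0) ∧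
    (∀ x ∈ W, ∀ a b : ℝ, (∀ σ ∈ Ioo a b, χ x + σ • EuclideanSpace.single 0 1 ∈ O) →
      IsMIntegralCurveOn (fun σ : ℝ ↦ χi (χ x + σ • EuclideanSpace.single 0 1)) K (Ioo a b)) ∧
    (∀ (γ : ℝ → 𝓑.carrier) (a b t₀ : ℝ), t₀ ∈ Ioo a b → IsMIntegralCurveOn γ K (Ioo a b) →
      (∀ t ∈ Ioo a b, γ t ∈ W) →
      ∀ t ∈ Ioo a b, χ (γ t) = χ (γ t₀) + (t - t₀) • EuclideanSpace.single 0 1))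

include hcharts

/-- **A maximal `K`-line in `𝓔⁺` is not prolonged inside `𝓔⁺` by any continuous curve.** If `θ`
is an integral curve of `K` in `𝓔⁺` on the non-empty open interval `D` which contains the domain
of every integral curve of `K` in `𝓔⁺` extending it, every point of `𝓔⁺` has a `K`-chart, and a
curve `η`, continuous at the points of an interval `T ⊇ D` and mapping `T` into `𝓔⁺`, agrees with
`θ` on `D`, then `T ⊆ D`: else a segment from `D` to `T ∖ D` contains an endpoint `β ∉ D` of `D`
(connectedness), `θ → η β` at `β` inside `D`, and `extend_past_limitPoint` applies. [cite: LeeSmoothManifolds2013, Thm. 9.12 (a)] -/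
private theorem subset_of_forall_extension_subset {θ : ℝ → 𝓑.carrier} {D : Set ℝ} (hD : IsOpen D)
    (hDc : D.OrdConnected) (hDne : D.Nonempty) (hθ : IsMIntegralCurveOn θ K D)
    (hθE : ∀ t ∈ D, θ t ∈ 𝓑.horizon)
    (hmax : ∀ (γ₂ : ℝ → 𝓑.carrier) (J₂ : Set ℝ), IsOpen J₂ → J₂.OrdConnected → D ⊆ J₂ →
      EqOn γ₂ θ D → IsMIntegralCurveOn γ₂ K J₂ → (∀ t ∈ J₂, γ₂ t ∈ 𝓑.horizon) → J₂ ⊆ D)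
    {η : ℝ → 𝓑.carrier} {T : Set ℝ} (hTc : T.OrdConnected) (hDT : D ⊆ T) (hηθ : EqOn η θ D)
    (hηc : ∀ u ∈ T, ContinuousAt η u) (hηE : ∀ u ∈ T, η u ∈ 𝓑.horizon) : T ⊆ D := by
  intro u' hu'
  by_contra hu'D
  obtain ⟨u₀, hu₀⟩ := hDne
  -- an endpoint of `D` between `u₀ ∈ D` and `u' ∉ D`
  obtain ⟨β, hβcl, hβseg, hβD⟩ : ∃ β, β ∈ closure D ∧ β ∈ uIcc u₀ u' ∧ β ∉ D := by
    by_contra h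
    push Not at h
    exact hu'D (isPreconnected_uIcc.subset_of_closure_inter_subset hD ⟨u₀, left_mem_uIcc, hu₀⟩
      (fun x hx ↦ h x hx.1 hx.2) right_mem_uIcc)
  have hβT : β ∈ T := hTc.uIcc_subset (hDT hu₀) hu' hβseg
  have hq : η β ∈ 𝓑.horizon := hηE β hβT
  have hlim : Tendsto θ (𝓝[D] β) (𝓝 (η β)) :=
    ((hηc β hβT).tendsto.mono_left nhdsWithin_le_nhds).congr'
      (eventually_mem_nhdsWithin.mono fun u hu ↦ hηθ hu)
  obtain ⟨W, O, χ, χi, hWo, hOo, -, hqW, -, hWinv, hOinv, hχ, -, -, hhor, hlines, hread⟩ :=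
    hcharts _ hq
  obtain ⟨γ₂, J₂, hJ₂o, hJ₂c, hDJ₂, hβJ₂, hEq, hint, hE⟩ :=
    extend_past_limitPoint hD hDc hθ hθE hβcl hlim hq hWo hOo hqW hWinv hOinv hχ.continuousOn hhor
      hlines hread
  exact hβD (hmax γ₂ J₂ hJ₂o hJ₂c hDJ₂ hEq hint hE hβJ₂)

/-- **(GEN) `K`-lines in `𝓔⁺` lie on generators.** With the sign `ε` and the null-geodesic
property of reparametrised `K`-lines in `𝓔⁺` (SEC-3a) and `K`-charts at the points of `𝓔⁺`: every
integral curve `γ₀` of `K` on `(a, b)`, `a < b`, inside `𝓔⁺` is `t ↦ γ (ε t)` for the generator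
`γ t = θ (ε t)` of `𝓔⁺` on `{t | ε t ∈ D}` (`IsNullGeneratorOf`), `(θ, D)` the maximal `K`-line
through `γ₀` (`exists_maximal_line`): a null geodesic segment in `𝓔⁺` (SEC-3a on bounded
subintervals of `D`), maximal among such since these are continuous
(`IsGeodesicOn.mdifferentiableAt_holds`, `subset_of_forall_extension_subset`). [cite: ChruscielCosta2008, §4.1] -/
private theorem gen [𝓑.metric.HasLeviCivita] (hU : IsOpen U) (hEU : 𝓑.horizon ⊆ U)
    (hK : 𝓑.metric.toPseudoRiemannianMetric.IsKillingFieldOn K U) {ε : ℝ} (hε : ε = 1 ∨ ε = -1)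
    (hnl : ∀ (γ₀ : ℝ → 𝓑.carrier) (a b : ℝ), IsMIntegralCurveOn γ₀ K (Ioo a b) →
      (∀ t ∈ Ioo a b, γ₀ t ∈ 𝓑.horizon) →
      𝓑.metric.IsNullGeodesicIn 𝓑.timeOrientation 𝓑.horizon (fun t : ℝ ↦ γ₀ (ε * t))
        {t : ℝ | ε * t ∈ Ioo a b})
    {γ₀ : ℝ → 𝓑.carrier} {a b : ℝ} (hab : a < b) (hγ₀ : IsMIntegralCurveOn γ₀ K (Ioo a b))
    (hγ₀E : ∀ t ∈ Ioo a b, γ₀ t ∈ 𝓑.horizon) :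
    ∃ (γ : ℝ → 𝓑.carrier) (s : Set ℝ) (ε t₁ : ℝ), 𝓑.toSpacetime.IsNullGeneratorOf 𝓑.horizon γ s ∧
      (ε = 1 ∨ ε = -1) ∧ ∀ t ∈ Ioo a b, ε * t + t₁ ∈ s ∧ γ (ε * t + t₁) = γ₀ t := by
  obtain ⟨θ, D, hD, hDc, habD, hθγ₀, hθ, hθE, hmax⟩ := exists_maximal_line hU hEU hK hab hγ₀ hγ₀E
  have hε0 : ε ≠ 0 := by rcases hε with rfl | rfl <;> norm_num
  have hεt : ∀ t, ε * (ε * t) = t := fun t ↦ by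
    rw [← mul_assoc, show ε * ε = 1 by rcases hε with rfl | rfl <;> norm_num, one_mul]
  -- pointwise, `t ↦ θ (ε t)` is a null geodesic segment in `𝓔⁺` near every parameter
  have hloc : ∀ t : ℝ, ε * t ∈ D → ∃ a' b' : ℝ, ε * t ∈ Ioo a' b' ∧
      𝓑.metric.IsNullGeodesicIn 𝓑.timeOrientation 𝓑.horizon (fun t : ℝ ↦ θ (ε * t))
        {t : ℝ | ε * t ∈ Ioo a' b'} := by
    intro t ht
    obtain ⟨ρ, hρ, hball⟩ := Metric.isOpen_iff.1 hD _ ht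
    rw [Real.ball_eq_Ioo] at hball
    exact ⟨_, _, ⟨by linarith, by linarith⟩, hnl θ _ _ (hθ.mono hball)
      fun u hu ↦ hθE u (hball hu)⟩
  refine ⟨fun t ↦ θ (ε * t), {t | ε * t ∈ D}, ε, 0, ⟨?_, ?_, ?_⟩, hε, fun t ht ↦ ?_⟩
  · refine ⟨ordConnected_preimage_sign hε hDc, ⟨fun t ht ↦ ?_, fun t ht ↦ ?_⟩, fun t ht ↦ ?_,
      fun t ht ↦ hθE _ ht⟩ <;> obtain ⟨a', b', hmem, hng⟩ := hloc t ht
    exacts [hng.2.1.1 t hmem, hng.2.1.2 t hmem, hng.2.2.1 t hmem]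
  · refine ((Ioo_infinite hab).image (mul_right_injective₀ hε0).injOn).nontrivial.mono ?_
    rintro _ ⟨t, ht, rfl⟩
    show ε * (ε * t) ∈ D
    exact (hεt t).symm ▸ habD ht
  · intro γ' s' hγ' hss' heq t ht
    have hT : {u : ℝ | ε * u ∈ s'} ⊆ D := by
      refine subset_of_forall_extension_subset hcharts hD hDc ((nonempty_Ioo.2 hab).mono habD) hθ hθE
        (fun γ₂ J₂ hJo hJc hDJ hJeq hJint hJE ↦ (hmax γ₂ J₂ hJo hJc (habD.trans hDJ)
          (fun u hu ↦ (hJeq (habD hu)).trans (hθγ₀ hu)) hJint hJE).1)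
        (η := fun u ↦ γ' (ε * u)) (ordConnected_preimage_sign hε hγ'.1) (fun u hu ↦ ?_)
        (fun u hu ↦ ?_) (fun u hu ↦ ?_) (fun u hu ↦ hγ'.2.2.2 hu)
      · show ε * u ∈ s'
        exact hss' (show ε * (ε * u) ∈ D by rw [hεt]; exact hu)
      · have h := heq (show ε * (ε * u) ∈ D by rw [hεt]; exact hu)
        simp only [hεt] at h
        exact h
      · exact (IsGeodesicOn.mdifferentiableAt_holds hγ'.2.1 hu).continuousAt.comp
          (continuous_const.mul continuous_id).continuousAt
    show ε * t ∈ D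
    exact hT (show ε * (ε * t) ∈ s' by rw [hεt]; exact ht)
  · simp only [add_zero, mem_setOf_eq, hεt]
    exact ⟨habD ht, hθγ₀ ht⟩

end Charts

/-- **(INJ) A cross-section meets every chart line at most once.** If `x, x'` lie on a
cross-section `C` of `𝓔⁺` (`IsCrossSectionOf`) and in one `K`-chart with `χ x' = χ x + σ e₀`, then
`x' = x`: the chart line `u ↦ χi (χ x + u e₀)` on an open parameter interval around `[0, σ]` (`O`
open and convex) is an integral curve of `K` inside `𝓔⁺` joining `x` to `x'`, so by (GEN) it lies
on a generator of `𝓔⁺`, which meets `C` only once. Chruściel–Costa 2008, §4.1. [cite: ChruscielCosta2008, §4.1] -/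
private theorem inj {𝓑 : StationaryAFBlackHole.{0}} [𝓑.metric.HasLeviCivita]
    {K : Π x : 𝓑.carrier, TangentSpace (𝓡 4) x}
    (hgen : ∀ (γ₀ : ℝ → 𝓑.carrier) (a b : ℝ), a < b → IsMIntegralCurveOn γ₀ K (Ioo a b) →
      (∀ t ∈ Ioo a b, γ₀ t ∈ 𝓑.horizon) → ∃ (γ : ℝ → 𝓑.carrier) (s : Set ℝ) (ε t₁ : ℝ),
        𝓑.toSpacetime.IsNullGeneratorOf 𝓑.horizon γ s ∧ (ε = 1 ∨ ε = -1) ∧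
        ∀ t ∈ Ioo a b, ε * t + t₁ ∈ s ∧ γ (ε * t + t₁) = γ₀ t)
    {C : Set 𝓑.carrier} (hC : 𝓑.toSpacetime.IsCrossSectionOf 𝓑.horizon C)
    {W : Set 𝓑.carrier} {O : Set E4} {χ : 𝓑.carrier → E4} {χi : E4 → 𝓑.carrier} (hOo : IsOpen O)
    (hOc : Convex ℝ O) (hWinv : ∀ x ∈ W, χ x ∈ O ∧ χi (χ x) = x)
    (hOinv : ∀ y ∈ O, χi y ∈ W ∧ χ (χi y) = y) (hhor : ∀ x ∈ W, x ∈ 𝓑.horizon ↔ χ x 1 = 0)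
    (hlines : ∀ x ∈ W, ∀ a b : ℝ, (∀ σ ∈ Ioo a b, χ x + σ • EuclideanSpace.single 0 1 ∈ O) →
      IsMIntegralCurveOn (fun σ : ℝ ↦ χi (χ x + σ • EuclideanSpace.single 0 1)) K (Ioo a b))
    {x x' : 𝓑.carrier} (hx : x ∈ W ∩ C) (hx' : x' ∈ W ∩ C) {σ : ℝ}
    (hσ : χ x' = χ x + σ • EuclideanSpace.single 0 1) : x' = x := by
  set e₀ : E4 := EuclideanSpace.single 0 1 with he₀
  -- the parameters of the chart line through `x` inside `O`: an open interval containing `0, σ`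
  set P : Set ℝ := {u | χ x + u • e₀ ∈ O} with hP
  have hPo : IsOpen P := hOo.preimage (by fun_prop : Continuous fun u : ℝ ↦ χ x + u • e₀)
  have hPc : P.OrdConnected := convex_iff_ordConnected.1
    ((hOc.translate_preimage_right (χ x)).is_linear_preimage (IsLinearMap.isLinearMap_smul' e₀))
  have h0P : (0 : ℝ) ∈ P := show χ x + (0 : ℝ) • e₀ ∈ O by
    simpa only [zero_smul, add_zero] using (hWinv x hx.1).1
  have hσP : σ ∈ P := show χ x + σ • e₀ ∈ O from hσ ▸ (hWinv x' hx'.1).1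
  obtain ⟨a', b', ha', hb', hsub⟩ :=
    Literature.Geometry.Manifold.exists_Ioo_subset_of_isOpen_ordConnected hPo hPc h0P hσP
  have h0I : (0 : ℝ) ∈ Ioo a' b' :=
    ⟨lt_of_lt_of_le ha' (min_le_left _ _), lt_of_le_of_lt (le_max_left _ _) hb'⟩
  have hσI : σ ∈ Ioo a' b' :=
    ⟨lt_of_lt_of_le ha' (min_le_right _ _), lt_of_le_of_lt (le_max_right _ _) hb'⟩
  -- the chart line, a `K`-line in `𝓔⁺` from `x` to `x'`
  set L : ℝ → 𝓑.carrier := fun u ↦ χi (χ x + u • e₀) with hL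
  have hLint : IsMIntegralCurveOn L K (Ioo a' b') := hlines x hx.1 a' b' fun u hu ↦ hsub hu
  have hx1 : χ x 1 = 0 := (hhor x hx.1).1 (LorentzianMetric.IsCrossSectionOf.subset hC hx.2)
  have hLE : ∀ u ∈ Ioo a' b', L u ∈ 𝓑.horizon := fun u hu ↦
    (hhor _ (hOinv _ (hsub hu)).1).2 (by rw [(hOinv _ (hsub hu)).2]; simp [he₀, hx1])
  have hL0 : L 0 = x := show χi (χ x + (0 : ℝ) • e₀) = x by
    simpa only [zero_smul, add_zero] using (hWinv x hx.1).2
  have hLσ : L σ = x' := show χi (χ x + σ • e₀) = x' from hσ ▸ (hWinv x' hx'.1).2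
  -- it lies on a generator, which meets `C` once
  obtain ⟨γ, s, ε, t₁, hγ, -, hγL⟩ := hgen L a' b' (h0I.1.trans h0I.2) hLint hLE
  obtain ⟨t, -, huniq⟩ := LorentzianMetric.IsCrossSectionOf.existsUnique hC hγ
  have e1 : ε * 0 + t₁ = t := huniq _ ⟨(hγL 0 h0I).1, by rw [(hγL 0 h0I).2, hL0]; exact hx.2⟩
  have e2 : ε * σ + t₁ = t := huniq _ ⟨(hγL σ hσI).1, by rw [(hγL σ hσI).2, hLσ]; exact hx'.2⟩
  calc x' = L σ := hLσ.symm
    _ = γ (ε * σ + t₁) := ((hγL σ hσI).2).symm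
    _ = γ (ε * 0 + t₁) := by rw [e2, e1]
    _ = L 0 := (hγL 0 h0I).2
    _ = x := hL0

/-- **SEC-3b (`K`-lines extend to generators; cross-sections meet chart lines once).** Registered
statement `stub_sec_generator`: in the setting of programme SEC (a Killing field `K` on an open
`U ⊇ 𝓔⁺`, nowhere zero, null, of constant time orientation, degenerate and locally tangent on `𝓔⁺`),
from the statement of SEC-3a (`hnull`: reparametrised `K`-lines in `𝓔⁺` are future null geodesic
segments) and the `K`-charts of SEC-1/2 (`hcharts`): (GEN) every `K`-line segment in `𝓔⁺` lies on a
generator of `𝓔⁺` (`gen`), and (INJ) a cross-section of `𝓔⁺` meets every chart line of a `K`-chart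
with convex coordinate range at most once (`inj`). Chruściel–Costa 2008, §4.1. [cite: ChruscielCosta2008, §4.1] -/
theorem stub_sec_generator : ∀ (𝓑 : StationaryAFBlackHole.{0}) [𝓑.metric.HasLeviCivita] (U : Set 𝓑.carrier) (K : Π x : 𝓑.carrier, TangentSpace (𝓡 4) x), IsOpen U → 𝓑.horizon ⊆ U → 𝓑.metric.toPseudoRiemannianMetric.IsKillingFieldOn K U → (∀ p ∈ 𝓑.horizon, K p ≠ 0) → (∀ p ∈ 𝓑.horizon, 𝓑.metric.val p (K p) (K p) = 0) → ((∀ p ∈ 𝓑.horizon, 𝓑.metric.val p (𝓑.timeOrientation.vectorField p) (K p) < 0) ∨ (∀ p ∈ 𝓑.horizon, 0 < 𝓑.metric.val p (𝓑.timeOrientation.vectorField p) (K p))) → (∀ p ∈ 𝓑.horizon, 𝓑.metric.leviCivita K p (K p) = 0) → (∀ p ∈ 𝓑.horizon, ∃ ε > (0 : ℝ), ∃ γ : ℝ → 𝓑.carrier, γ 0 = p ∧ IsMIntegralCurveOn γ K (Ioo (-ε) ε) ∧ ∀ t ∈ Ioo (-ε) ε, γ t ∈ 𝓑.horizon) → (∀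 (𝓑 : StationaryAFBlackHole.{0}) [𝓑.metric.HasLeviCivita] (U : Set 𝓑.carrier) (K : Π x : 𝓑.carrier, TangentSpace (𝓡 4) x), IsOpen U → 𝓑.horizon ⊆ U → 𝓑.metric.toPseudoRiemannianMetric.IsKillingFieldOn K U → (∀ p ∈ 𝓑.horizon, K p ≠ 0) → (∀ p ∈ 𝓑.horizon, 𝓑.metric.val p (K p) (K p) = 0) → ((∀ p ∈ 𝓑.horizon, 𝓑.metric.val p (𝓑.timeOrientation.vectorField p) (K p) < 0) ∨ (∀ p ∈ 𝓑.horizon, 0 < 𝓑.metric.val p (𝓑.timeOrientation.vectorField p) (K p))) → (∀ p ∈ 𝓑.horizon, 𝓑.metric.leviCivita K p (K p) = 0) → ∃ ε : ℝ, (ε = 1 ∨ ε = -1) ∧ ∀ (γ₀ : ℝ → 𝓑.carrier) (a b : ℝ), IsMIntegralCurveOn γ₀ K (Ioo a b) → (∀ t ∈ Ioo a b, γ₀ t ∈ 𝓑.horizon) → 𝓑.metric.IsNullGeodesicIn 𝓑.timeOrientation 𝓑.horizon (fun t : ℝ ↦ γ₀ (ε * t)) {t : ℝ | ε * t ∈ Ioo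 a b} ∧ ∀ t : ℝ, ε * t ∈ Ioo a b → velocity (𝓡 4) (fun t : ℝ ↦ γ₀ (ε * t)) t = ε • K (γ₀ (ε * t))) →
    (∀ p ∈ 𝓑.horizon, ∃ (W : Set 𝓑.carrier) (O : Set E4) (χ : 𝓑.carrier → E4) (χi : E4 → 𝓑.carrier), IsOpen W ∧ IsOpen O ∧ W ⊆ U ∧ p ∈ W ∧ χ p = 0 ∧ (∀ x ∈ W, χ x ∈ O ∧ χi (χ x) = x) ∧ (∀ y ∈ O, χi y ∈ W ∧ χ (χi y) = y) ∧ ContMDiffOn (𝓡 4) 𝓘(ℝ, E4) ∞ χ W ∧ ContMDiffOn 𝓘(ℝ, E4) (𝓡 4) ∞ χi O ∧ (∀ x ∈ W, mfderiv (𝓡 4) 𝓘(ℝ, E4) χ x (K x) = EuclideanSpace.single 0 1) ∧ (∀ x ∈ W, x ∈ 𝓑.horizon ↔ χ x 1 = 0) ∧ (∀ x ∈ W, ∀ a b : ℝ, (∀ σ ∈ Ioo a b, χ x + σ • EuclideanSpace.single 0 1 ∈ O) → IsMIntegralCurveOn (fun σ : ℝ ↦ χi (χ x + σ • EuclideanSpace.single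 0 1)) K (Ioo a b)) ∧ (∀ (γ : ℝ → 𝓑.carrier) (a b t₀ : ℝ), t₀ ∈ Ioo a b → IsMIntegralCurveOn γ K (Ioo a b) → (∀ t ∈ Ioo a b, γ t ∈ W) → ∀ t ∈ Ioo a b, χ (γ t) = χ (γ t₀) + (t - t₀) • EuclideanSpace.single 0 1)) →
    (∀ (γ₀ : ℝ → 𝓑.carrier) (a b : ℝ), a < b → IsMIntegralCurveOn γ₀ K (Ioo a b) → (∀ t ∈ Ioo a b, γ₀ t ∈ 𝓑.horizon) → ∃ (γ : ℝ → 𝓑.carrier) (s : Set ℝ) (ε t₁ : ℝ), 𝓑.toSpacetime.IsNullGeneratorOf 𝓑.horizon γ s ∧ (ε = 1 ∨ ε = -1) ∧ ∀ t ∈ Ioo a b, ε * t + t₁ ∈ s ∧ γ (ε * t + t₁) = γ₀ t) ∧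
    (∀ C : Set 𝓑.carrier, 𝓑.toSpacetime.IsCrossSectionOf 𝓑.horizon C → ∀ (W : Set 𝓑.carrier) (O : Set E4) (χ : 𝓑.carrier → E4) (χi : E4 → 𝓑.carrier), IsOpen W → IsOpen O → Convex ℝ O → W ⊆ U → (∀ x ∈ W, χ x ∈ O ∧ χi (χ x) = x) → (∀ y ∈ O, χi y ∈ W ∧ χ (χi y) = y) → (∀ x ∈ W, x ∈ 𝓑.horizon ↔ χ x 1 = 0) → (∀ x ∈ W, ∀ a b : ℝ, (∀ σ ∈ Ioo a b, χ x + σ • EuclideanSpace.single 0 1 ∈ O) → IsMIntegralCurveOn (fun σ : ℝ ↦ χi (χ x + σ • EuclideanSpace.single 0 1)) K (Ioo a b)) → ∀ x ∈ W ∩ C, ∀ x' ∈ W ∩ C, ∀ σ : ℝ, χ x' = χ x + σ • EuclideanSpace.single 0 1 → x' = x) := by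
  intro 𝓑 _ U K hU hEU hK hK0 hKnull hdich hdeg _ hnull hcharts
  obtain ⟨ε, hε, hnl⟩ := hnull 𝓑 U K hU hEU hK hK0 hKnull hdich hdeg
  refine ⟨fun γ₀ a b hab hγ₀ hγ₀E ↦
    gen hcharts hU hEU hK hε (fun γ a b h1 h2 ↦ (hnl γ a b h1 h2).1) hab hγ₀ hγ₀E, ?_⟩
  exact fun C hC W O χ χi _ hOo hOc _ hWinv hOinv hhor hlines x hx x' hx' σ hσ ↦
    inj (fun γ₀ a b hab hγ₀ hγ₀E ↦ gen hcharts hU hEU hK hε (fun γ a b h1 h2 ↦ (hnl γ a b h1 h2).1)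
      hab hγ₀ hγ₀E) hC hOo hOc hWinv hOinv hhor hlines hx hx' hσ

end Summit.FinalStateConjecture.FinalStateConjecture.Theorems.HawkingExtensionIsKerr.SketchIdeator2

end
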